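import Mathlib
import HarnessLib
import Summits.AtomisticToContinuum.HydrodynamicLimit.Theses.MourreKoopmanCharges
import Summits.AtomisticToContinuum.HydrodynamicLimit.Theses.FluxGibbsianityLdDrude
import Summits.AtomisticToContinuum.HydrodynamicLimit.Theorems.MourreKoopmanChargesOneBodyCompletenessTorusMoments
import Summits.AtomisticToContinuum.HydrodynamicLimit.Theorems.MourreKoopmanChargesOneBodyCompletenessTorusStatics

/-!
# Line `torus-fejer` v2 (lead c4) for the crux `OneBodyCompleteness` (stmt-AtomisticToContinuum-9583),
# route `MourreKoopmanCharges`, sub-problem `HydrodynamicLimit`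

Skeleton v2 of the strategist line `Lines/torus_fejer.lean` (s2, v1: 4 stubs), reshaped by lead c4:

* the OPEN CORE `stub_coreFejer` (uniform-in-`N` Euler-window variance decay for bounded profiles
  `g ⊥ {1, v, |v|²}` and Fourier test functions) is kept verbatim, AND bridged to the EXISTING open typed
  item `FastObservableMeanErgodic` (stmt-AtomisticToContinuum-10952, route `FluxGibbsianityLdDrude`,
  shared with `AntiMazurCertificates`) by the provable TRANSFER STUB `stub_coreFejerOfFOME`
  (thermal scaling `v ↦ v/√θ`, `t ↦ t√θ` of the torus hard-sphere flow — the tree's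
  `KineticWindowGronwallThermalScaling.thermalScale` / `lintegral_window_thermal` — makes the
  `θ`-dependent threshold `σ₀(θ)` of FOME uniform: `σ₀ := σ₀^{FOME}(a = 1, θ = 1, u₀ = 0)`);
* window monotonicity is split off as its own stub `stub_fejerWindowMonotone` for BOUNDED profiles
  (block decomposition on good orbits + invariance, the `L²` machinery of
  `SelfTilt.stub_squareWindowMonotone` / `AntiMazurCoboundariesVarianceCertificate`), so that the
  currency between the remaining stubs is decay at ALL large windows (`FejerDecayAll`);
* `stub_testFunctionDensityAll` (Fourier `χ` ⇒ continuous `χ`, bounded `g`, Stone–Weierstrass on `𝕋³`),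
  `stub_profileDensityAll` (bounded `g ⊥` ⇒ polynomially bounded `h ⊥`, density in `L²(M_θ)`),
  `stub_windowToCesaroAll` (all-window variance decay ⇒ the crux's Cesàro decay: Fubini + `2|xy| ≤ λx² + y²/λ`).

Compositions (sorry-free, kernel-checked below):
`OneBodyCompleteness_of : stub_coreFejer → mono → test → prof → win → OneBodyCompleteness` and
`OneBodyCompleteness_of_fastObservableMeanErgodic : stub_coreFejerOfFOME → mono → test → prof → win →
FastObservableMeanErgodic → OneBodyCompleteness` (the crux CLOSED MODULO the one existing item 10952 once
the five provable stubs land).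

Every stub signature is written over tree constants only (`localGibbsLaw`, `HardSphereFlow.flow`,
`empiricalMeasure`, `localMaxwellian`, `mFourier`, `FastObservableMeanErgodic`), so a `Theorems/` file can
state and prove each verbatim.
-/

noncomputable section

namespace Summit.AtomisticToContinuum.HydrodynamicLimit.Cruxes.OneBodyCompleteness.TorusFejer

open scoped BigOperators ENNReal
open MeasureTheory Filter Set
open Literature.MathematicalPhysics.KineticTheory Literature.Analysis.FluidPDE
open Summit.AtomisticToContinuum.HydrodynamicLimit.Theses.MourreKoopmanCharges
open Summit.AtomisticToContinuum.HydrodynamicLimit.Theses.FluxGibbsianityLdDrude (FastObservableMeanErgodic)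
open UnitAddTorus

/-! ### Registered stubs (proofs admitted ONLY here) -/

/-- STUB S4 — THE OPEN CORE (torus Fejér decay for bounded profiles and Fourier test functions), verbatim
from v1.  There is `σ₀ > 0` such that for `0 < σ < σ₀`, `θ > 0`, every bounded continuous `g : ℝ³ → ℝ` that
is `M_θ`-orthogonal to `1, v, |v|²`, every flow family `Φ` and every wavenumber `n ∈ ℤ³`, with
`χ ∈ {Re e_n, Im e_n}`: for every `δ > 0` there are a window `T > 0` and `N₀` with
`(N+1) · E_{G_N}[(T⁻¹ ∫₀ᵀ A_g(χ)((Φ N)_{s(N+1)^{-1/3}} z) ds)²] ≤ δ` for all `N ≥ N₀`.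
[Spohn1991 §7.1; Doyon2022 §5.1; LepriLiviPoliti2003 §8] -/
theorem stub_coreFejer :
    ∃ σ₀ : ℝ, 0 < σ₀ ∧ ∀ σ : ℝ, 0 < σ → σ < σ₀ → ∀ θ : ℝ, 0 < θ →
      ∀ g : V3 → ℝ, Continuous g → (∃ K : ℝ, ∀ v, |g v| ≤ K) →
        (∫ v, g v * localMaxwellian 1 θ (0 : V3) v = 0) →
        (∀ i : Fin 3, ∫ v, g v * v i * localMaxwellian 1 θ (0 : V3) v = 0) →
        (∫ v, g v * ‖v‖ ^ 2 * localMaxwellian 1 θ (0 : V3) v = 0) →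
        ∀ (Φ : (N : ℕ) → HardSphereFlow (Torus.geometry (Fin 3)) (hsDiameter σ N) (N + 1))
          (n : Fin 3 → ℤ),
          (∀ δ : ℝ, 0 < δ → ∃ T : ℝ, 0 < T ∧ ∃ N₀ : ℕ, ∀ N : ℕ, N₀ ≤ N →
            ∫⁻ z, ENNReal.ofReal ((T⁻¹ * ∫ s in (0 : ℝ)..T,
                ∫ y, (mFourier n y.1).re * g y.2
                  ∂(empiricalMeasure ((Φ N).flow (s * ((N : ℝ) + 1) ^ (-(1 / 3 : ℝ))) z))) ^ 2)
              ∂(localGibbsLaw σ (fun _ => 1) (fun _ => 0) (fun _ => θ) N (Φ N))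
              ≤ ENNReal.ofReal (δ / ((N : ℝ) + 1))) ∧
          (∀ δ : ℝ, 0 < δ → ∃ T : ℝ, 0 < T ∧ ∃ N₀ : ℕ, ∀ N : ℕ, N₀ ≤ N →
            ∫⁻ z, ENNReal.ofReal ((T⁻¹ * ∫ s in (0 : ℝ)..T,
                ∫ y, (mFourier n y.1).im * g y.2
                  ∂(empiricalMeasure ((Φ N).flow (s * ((N : ℝ) + 1) ^ (-(1 / 3 : ℝ))) z))) ^ 2)
              ∂(localGibbsLaw σ (fun _ => 1) (fun _ => 0) (fun _ => θ) N (Φ N))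
              ≤ ENNReal.ofReal (δ / ((N : ℝ) + 1))) := by
  sorry

/-- STUB S4' — TRANSFER (provable, L): the existing typed item `FastObservableMeanErgodic`
(stmt-AtomisticToContinuum-10952: at fixed `a, θ, u₀` a threshold `σ₀(θ)`, all continuous `φ`, bounded
continuous `g ⊥ {1, v, |v|²}` in `L²(γ)`, `∀ δ ∃ τ ∃ N₀ ∀ N ∀ Φ`, un-normalised sums, window
`τ(N+1)^{-1/3}` of flow time, profile `g((√θ)⁻¹ • (v - u₀))`) implies the core, with the `θ`-UNIFORM
threshold `σ₀ := σ₀^{FOME}(1, 1, 0)`: apply FOME at unit temperature to the thermally rescaled flow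
`Ψ := thermalScale (Φ N) (√θ)⁻¹` and the profile `g(√θ ·)` (bounded, continuous, `γ`-orthogonal to
`c₀ + ⟪b, v⟫ + c₂|v|²` by `integral_comp_sqrt_smul_stdGaussian` and the three `M_θ`-orthogonality relations),
transport the window functional back with `KineticWindowGronwallThermalScaling.lintegral_window_thermal`
(`(scaleVel (√θ)⁻¹)_# G_N(1,0,θ) = G_N(1,0,1)`, `Ψ_s ∘ scaleVel = scaleVel ∘ Φ_{s/√θ}`), change variables
`s ↦ s(N+1)^{-1/3}` (`intervalIntegral.integral_comp_mul_right`), window `T := τ/√θ`, and divide by `(N+1)²`.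
[Spohn1991 §7.1; tree: thermalScale, lintegral_window_thermal, integral_comp_sqrt_smul_stdGaussian] -/
theorem stub_coreFejerOfFOME : FastObservableMeanErgodic →
    ∃ σ₀ : ℝ, 0 < σ₀ ∧ ∀ σ : ℝ, 0 < σ → σ < σ₀ → ∀ θ : ℝ, 0 < θ →
      ∀ g : V3 → ℝ, Continuous g → (∃ K : ℝ, ∀ v, |g v| ≤ K) →
        (∫ v, g v * localMaxwellian 1 θ (0 : V3) v = 0) →
        (∀ i : Fin 3, ∫ v, g v * v i * localMaxwellian 1 θ (0 : V3) v = 0) →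
        (∫ v, g v * ‖v‖ ^ 2 * localMaxwellian 1 θ (0 : V3) v = 0) →
        ∀ (Φ : (N : ℕ) → HardSphereFlow (Torus.geometry (Fin 3)) (hsDiameter σ N) (N + 1))
          (n : Fin 3 → ℤ),
          (∀ δ : ℝ, 0 < δ → ∃ T : ℝ, 0 < T ∧ ∃ N₀ : ℕ, ∀ N : ℕ, N₀ ≤ N →
            ∫⁻ z, ENNReal.ofReal ((T⁻¹ * ∫ s in (0 : ℝ)..T,
                ∫ y, (mFourier n y.1).re * g y.2
                  ∂(empiricalMeasure ((Φ N).flow (s * ((N : ℝ) + 1) ^ (-(1 / 3 : ℝ))) z))) ^ 2)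
              ∂(localGibbsLaw σ (fun _ => 1) (fun _ => 0) (fun _ => θ) N (Φ N))
              ≤ ENNReal.ofReal (δ / ((N : ℝ) + 1))) ∧
          (∀ δ : ℝ, 0 < δ → ∃ T : ℝ, 0 < T ∧ ∃ N₀ : ℕ, ∀ N : ℕ, N₀ ≤ N →
            ∫⁻ z, ENNReal.ofReal ((T⁻¹ * ∫ s in (0 : ℝ)..T,
                ∫ y, (mFourier n y.1).im * g y.2
                  ∂(empiricalMeasure ((Φ N).flow (s * ((N : ℝ) + 1) ^ (-(1 / 3 : ℝ))) z))) ^ 2)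
              ∂(localGibbsLaw σ (fun _ => 1) (fun _ => 0) (fun _ => θ) N (Φ N))
              ≤ ENNReal.ofReal (δ / ((N : ℝ) + 1))) := by
  sorry

/-- STUB S0 — WINDOW MONOTONICITY (provable, M; bounded profiles).  Fix `0 < σ < 1/2`, `θ > 0`, a bounded
continuous mean-zero profile `g`, a flow family `Φ` and a continuous `χ`.  Decay of the window variance of
`A_g(χ)` at ONE window (`∀ δ ∃ T ∃ N₀ ∀ N ≥ N₀`) implies decay at ALL large windows
(`∀ δ ∃ T₀ ∀ T ≥ T₀ ∃ N₀ ∀ N ≥ N₀`).  Proof plan: after `s ↦ s(N+1)^{-1/3}` the functional is a plain window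
average of the bounded measurable observable `A = A_g(χ)` along `Φ N`; on good orbits, for `S = kT + r`
(`k ≥ 1`, `0 ≤ r < T`), `avg_S = (kT/S)·k⁻¹Σ_{j<k} avg_T ∘ (Φ_T)^[j] + S⁻¹∫_{kT}^{S} A∘Φ_s`
(`flow_add` on the good set, `KineticWindowGronwallWindowSubadditivity.window_eq_cesaro`); `(x+y)² ≤ 2x²+2y²`;
the Cesàro block has second moment `≤ E[(avg_T)²]` (`SelfTilt.lintegral_sq_cesaro_le_of_aemeasurable`,
invariance `measurePreserving_flow_localGibbsLaw_const`); the tail has second moment `≤ (r/S)² E[A²]`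
(Cauchy–Schwarz in time + Tonelli + invariance, `AntiMazurCoboundariesVarianceCertificate.lintegral_ofReal_window`)
and `(N+1)E[A²] = (∫χ²)(∫g²M_θ)` (`torusStaticVariance`); so `(N+1)E[(avg_S)²] ≤ 2δ' + 2(T/S)²(∫χ²)(∫g²M_θ)`,
and `T₀ := T·max 1 (2√(M/δ))`, `δ' := δ/4` do it (same `N₀` for all `S`).
[Spohn1991 §7.1; tree: stub_squareWindowMonotone, lintegral_ofReal_window, torusStaticVariance] -/
theorem stub_fejerWindowMonotone :
    ∀ σ : ℝ, 0 < σ → σ < 1 / 2 → ∀ θ : ℝ, 0 < θ →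
      ∀ g : V3 → ℝ, Continuous g → (∃ K : ℝ, ∀ v, |g v| ≤ K) →
        (∫ v, g v * localMaxwellian 1 θ (0 : V3) v = 0) →
        ∀ (Φ : (N : ℕ) → HardSphereFlow (Torus.geometry (Fin 3)) (hsDiameter σ N) (N + 1))
          (χ : T3 → ℝ), Continuous χ →
          (∀ δ : ℝ, 0 < δ → ∃ T : ℝ, 0 < T ∧ ∃ N₀ : ℕ, ∀ N : ℕ, N₀ ≤ N →
            ∫⁻ z, ENNReal.ofReal ((T⁻¹ * ∫ s in (0 : ℝ)..T,
                ∫ y, χ y.1 * g y.2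
                  ∂(empiricalMeasure ((Φ N).flow (s * ((N : ℝ) + 1) ^ (-(1 / 3 : ℝ))) z))) ^ 2)
              ∂(localGibbsLaw σ (fun _ => 1) (fun _ => 0) (fun _ => θ) N (Φ N))
              ≤ ENNReal.ofReal (δ / ((N : ℝ) + 1))) →
          ∀ δ : ℝ, 0 < δ → ∃ T₀ : ℝ, 0 < T₀ ∧ ∀ T : ℝ, T₀ ≤ T → ∃ N₀ : ℕ, ∀ N : ℕ, N₀ ≤ N →
            ∫⁻ z, ENNReal.ofReal ((T⁻¹ * ∫ s in (0 : ℝ)..T,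
                ∫ y, χ y.1 * g y.2
                  ∂(empiricalMeasure ((Φ N).flow (s * ((N : ℝ) + 1) ^ (-(1 / 3 : ℝ))) z))) ^ 2)
              ∂(localGibbsLaw σ (fun _ => 1) (fun _ => 0) (fun _ => θ) N (Φ N))
              ≤ ENNReal.ofReal (δ / ((N : ℝ) + 1)) := by
  sorry

/-- STUB S2 — TEST-FUNCTION DENSITY at all large windows (provable, M; bounded profiles).  Fix
`0 < σ < 1/2`, `θ > 0`, a bounded continuous mean-zero `g` and a flow family `Φ`.  If the window variance of
`A_g(χ)` decays at all large windows for `χ = Re e_n` and `χ = Im e_n`, every `n ∈ ℤ³`, then it does so for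
every continuous `χ : 𝕋³ → ℝ`.  Proof plan: real trigonometric polynomials `P = Σ_{n∈F} (a_n Re e_n + b_n Im e_n)`
are `‖·‖_∞`-dense in `C(𝕋³, ℝ)` (real parts of `UnitAddTorus.mFourierSubalgebra`, whose closure is `⊤`);
`A_g(χ)` is linear in `χ`; `(Σ_{i≤m} x_i)² ≤ m Σ x_i²`; the error piece obeys, for EVERY window and `N`,
`(N+1)E[(avg_T A_g(χ − P))²] ≤ (N+1)E[A_g(χ−P)²] = (∫(χ−P)²)(∫g²M_θ) ≤ ‖χ−P‖_∞² ∫g²M_θ` (Cauchy–Schwarz in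
time + Tonelli + invariance; `torusStaticVariance`); finitely many Fourier pieces share the window
`T₀ := max_n T₀(n)` and, at each `T ≥ T₀`, the threshold `N₀ := max_n N₀(n, T)`.
[Spohn1991 §7.1; Mathlib Analysis.Fourier.AddCircleMulti; tree: torusStaticVariance, lintegral_ofReal_window] -/
theorem stub_testFunctionDensityAll :
    ∀ σ : ℝ, 0 < σ → σ < 1 / 2 → ∀ θ : ℝ, 0 < θ →
      ∀ g : V3 → ℝ, Continuous g → (∃ K : ℝ, ∀ v, |g v| ≤ K) →
        (∫ v, g v * localMaxwellian 1 θ (0 : V3) v = 0) →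
        ∀ Φ : (N : ℕ) → HardSphereFlow (Torus.geometry (Fin 3)) (hsDiameter σ N) (N + 1),
          (∀ n : Fin 3 → ℤ,
            (∀ δ : ℝ, 0 < δ → ∃ T₀ : ℝ, 0 < T₀ ∧ ∀ T : ℝ, T₀ ≤ T → ∃ N₀ : ℕ, ∀ N : ℕ, N₀ ≤ N →
              ∫⁻ z, ENNReal.ofReal ((T⁻¹ * ∫ s in (0 : ℝ)..T,
                  ∫ y, (mFourier n y.1).re * g y.2
                    ∂(empiricalMeasure ((Φ N).flow (s * ((N : ℝ) + 1) ^ (-(1 / 3 : ℝ))) z))) ^ 2)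
                ∂(localGibbsLaw σ (fun _ => 1) (fun _ => 0) (fun _ => θ) N (Φ N))
                ≤ ENNReal.ofReal (δ / ((N : ℝ) + 1))) ∧
            (∀ δ : ℝ, 0 < δ → ∃ T₀ : ℝ, 0 < T₀ ∧ ∀ T : ℝ, T₀ ≤ T → ∃ N₀ : ℕ, ∀ N : ℕ, N₀ ≤ N →
              ∫⁻ z, ENNReal.ofReal ((T⁻¹ * ∫ s in (0 : ℝ)..T,
                  ∫ y, (mFourier n y.1).im * g y.2
                    ∂(empiricalMeasure ((Φ N).flow (s * ((N : ℝ) + 1) ^ (-(1 / 3 : ℝ))) z))) ^ 2)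
                ∂(localGibbsLaw σ (fun _ => 1) (fun _ => 0) (fun _ => θ) N (Φ N))
                ≤ ENNReal.ofReal (δ / ((N : ℝ) + 1)))) →
          ∀ χ : T3 → ℝ, Continuous χ →
            ∀ δ : ℝ, 0 < δ → ∃ T₀ : ℝ, 0 < T₀ ∧ ∀ T : ℝ, T₀ ≤ T → ∃ N₀ : ℕ, ∀ N : ℕ, N₀ ≤ N →
              ∫⁻ z, ENNReal.ofReal ((T⁻¹ * ∫ s in (0 : ℝ)..T,
                  ∫ y, χ y.1 * g y.2
                    ∂(empiricalMeasure ((Φ N).flow (s * ((N : ℝ) + 1) ^ (-(1 / 3 : ℝ))) z))) ^ 2)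
                ∂(localGibbsLaw σ (fun _ => 1) (fun _ => 0) (fun _ => θ) N (Φ N))
                ≤ ENNReal.ofReal (δ / ((N : ℝ) + 1)) := by
  sorry

/-- STUB S3 — PROFILE DENSITY at all large windows (provable, M).  Fix `0 < σ < 1/2`, `θ > 0`, a flow family
`Φ` and a continuous `χ`.  If the window variance decays at all large windows for EVERY bounded continuous
`g ⊥ {1, v, |v|²}` (in `L²(M_θ)`), then it does so for every continuous polynomially bounded
`h ⊥ {1, v, |v|²}`.  Proof plan: (i) DENSITY: bounded continuous functions that are `M_θ`-orthogonal to the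
five functions `1, v₁, v₂, v₃, |v|²` are `L²(M_θ)`-dense among all `L²(M_θ)` functions orthogonal to them
(bounded continuous functions are dense, `MeasureTheory.MemLp.exists_boundedContinuous_eLpNorm_sub_le`; a dense
subspace meets the kernel of finitely many continuous functionals densely: correct an approximant `b` by
`Σ_j φ_j(b) w_j` with bounded continuous `w_j`, inductively on the functionals); (ii) SEMINORM: for mean-zero
continuous polynomially bounded `f` and every window and `N`,
`(N+1)E[(avg_T A_f(χ))²] ≤ (N+1)E[A_f(χ)²] = (∫χ²)(∫f²M_θ)` (Cauchy–Schwarz in time for a.e. orbit, Tonelli,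
invariance; `torusStaticVariance`, `memLp_two_oneBodyField_localGibbsLaw_one`); (iii) `A_h = A_g + A_{h−g}`,
`(x+y)² ≤ 2x²+2y²`, choose `g` with `(∫χ²)∫(h−g)²M_θ ≤ δ/4`, then the hypothesis for `g` at `δ/4`.
[Spohn1991 §7.1; tree: torusStaticVariance, memLp_two_oneBodyField_localGibbsLaw_one] -/
theorem stub_profileDensityAll :
    ∀ σ : ℝ, 0 < σ → σ < 1 / 2 → ∀ θ : ℝ, 0 < θ →
      ∀ (Φ : (N : ℕ) → HardSphereFlow (Torus.geometry (Fin 3)) (hsDiameter σ N) (N + 1))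
        (χ : T3 → ℝ), Continuous χ →
        (∀ g : V3 → ℝ, Continuous g → (∃ K : ℝ, ∀ v, |g v| ≤ K) →
          (∫ v, g v * localMaxwellian 1 θ (0 : V3) v = 0) →
          (∀ i : Fin 3, ∫ v, g v * v i * localMaxwellian 1 θ (0 : V3) v = 0) →
          (∫ v, g v * ‖v‖ ^ 2 * localMaxwellian 1 θ (0 : V3) v = 0) →
          ∀ δ : ℝ, 0 < δ → ∃ T₀ : ℝ, 0 < T₀ ∧ ∀ T : ℝ, T₀ ≤ T → ∃ N₀ : ℕ, ∀ N : ℕ, N₀ ≤ N →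
            ∫⁻ z, ENNReal.ofReal ((T⁻¹ * ∫ s in (0 : ℝ)..T,
                ∫ y, χ y.1 * g y.2
                  ∂(empiricalMeasure ((Φ N).flow (s * ((N : ℝ) + 1) ^ (-(1 / 3 : ℝ))) z))) ^ 2)
              ∂(localGibbsLaw σ (fun _ => 1) (fun _ => 0) (fun _ => θ) N (Φ N))
              ≤ ENNReal.ofReal (δ / ((N : ℝ) + 1))) →
        ∀ h : V3 → ℝ, Continuous h → (∃ (C : ℝ) (k : ℕ), ∀ v, |h v| ≤ C * (1 + ‖v‖) ^ k) →
          (∫ v, h v * localMaxwellian 1 θ (0 : V3) v = 0) →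
          (∀ i : Fin 3, ∫ v, h v * v i * localMaxwellian 1 θ (0 : V3) v = 0) →
          (∫ v, h v * ‖v‖ ^ 2 * localMaxwellian 1 θ (0 : V3) v = 0) →
          ∀ δ : ℝ, 0 < δ → ∃ T₀ : ℝ, 0 < T₀ ∧ ∀ T : ℝ, T₀ ≤ T → ∃ N₀ : ℕ, ∀ N : ℕ, N₀ ≤ N →
            ∫⁻ z, ENNReal.ofReal ((T⁻¹ * ∫ s in (0 : ℝ)..T,
                ∫ y, χ y.1 * h y.2
                  ∂(empiricalMeasure ((Φ N).flow (s * ((N : ℝ) + 1) ^ (-(1 / 3 : ℝ))) z))) ^ 2)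
              ∂(localGibbsLaw σ (fun _ => 1) (fun _ => 0) (fun _ => θ) N (Φ N))
              ≤ ENNReal.ofReal (δ / ((N : ℝ) + 1)) := by
  sorry

/-- STUB S1 — ALL-WINDOW VARIANCE DECAY ⇒ CESÀRO DECAY (provable, M).  Fix `0 < σ < 1/2`, `θ > 0`, a
continuous polynomially bounded mean-zero `h`, a flow family `Φ` and a continuous `χ`.  If the window
variance of `A = A_h(χ)` decays at all large windows, the crux's conclusion holds at `(σ, θ, h, Φ, χ)`.
Proof plan (finite `N`, exact): with `c_N(s) = (N+1)E[A((Φ N)_{s(N+1)^{-1/3}} z) A(z)]`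
(`= (N+1)·cov`, `stub_torusMoments` (i)) and `M := (∫χ²)(∫h²M_θ) = (N+1)E[A²]` (`torusStaticVariance`):
FUBINI `S⁻¹∫₀^S c_N = (N+1)E[avg_S(A∘Φ)(z)·A(z)]` (joint a.e.-measurability
`AntiMazurCoboundariesVarianceCertificate.aemeasurable_flow_prod`, integrability from
`|A(Φ_s z)A(z)| ≤ (A(Φ_s z)² + A(z)²)/2`, Tonelli and invariance; `MeasureTheory.integral_integral_swap`), then
`2|xy| ≤ λx² + y²/λ` with `λ := (M+1)/δ`: `|S⁻¹∫₀^S c_N| ≤ ((M+1)/2δ)(N+1)E[avg_S²] + δM/(2(M+1)) ≤ δ` as soon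
as `(N+1)E[avg_S²] ≤ δ²/(M+1)`, i.e. `S₀ := T₀(δ²/(M+1))`, `N₀ := N₀(S)`.
[Spohn1991 §7.1 (Fejér vs Cesàro); tree: stub_torusMoments, torusStaticVariance, aemeasurable_flow_prod] -/
theorem stub_windowToCesaroAll :
    ∀ σ : ℝ, 0 < σ → σ < 1 / 2 → ∀ θ : ℝ, 0 < θ →
      ∀ h : V3 → ℝ, Continuous h → (∃ (C : ℝ) (k : ℕ), ∀ v, |h v| ≤ C * (1 + ‖v‖) ^ k) →
        (∫ v, h v * localMaxwellian 1 θ (0 : V3) v = 0) →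
        ∀ (Φ : (N : ℕ) → HardSphereFlow (Torus.geometry (Fin 3)) (hsDiameter σ N) (N + 1))
          (χ : T3 → ℝ), Continuous χ →
          (∀ δ : ℝ, 0 < δ → ∃ T₀ : ℝ, 0 < T₀ ∧ ∀ T : ℝ, T₀ ≤ T → ∃ N₀ : ℕ, ∀ N : ℕ, N₀ ≤ N →
            ∫⁻ z, ENNReal.ofReal ((T⁻¹ * ∫ s in (0 : ℝ)..T,
                ∫ y, χ y.1 * h y.2
                  ∂(empiricalMeasure ((Φ N).flow (s * ((N : ℝ) + 1) ^ (-(1 / 3 : ℝ))) z))) ^ 2)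
              ∂(localGibbsLaw σ (fun _ => 1) (fun _ => 0) (fun _ => θ) N (Φ N))
              ≤ ENNReal.ofReal (δ / ((N : ℝ) + 1))) →
          ∀ δ : ℝ, 0 < δ → ∃ S₀ : ℝ, 0 < S₀ ∧ ∀ S : ℝ, S₀ ≤ S → ∃ N₀ : ℕ, ∀ N : ℕ, N₀ ≤ N →
            |S⁻¹ * ∫ s in (0 : ℝ)..S, ((N : ℝ) + 1) * ∫ z,
                (∫ y, χ y.1 * h y.2
                    ∂(empiricalMeasure ((Φ N).flow (s * ((N : ℝ) + 1) ^ (-(1 / 3 : ℝ))) z))) *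
                  (∫ y, χ y.1 * h y.2 ∂(empiricalMeasure z))
                ∂(localGibbsLaw σ (fun _ => 1) (fun _ => 0) (fun _ => θ) N (Φ N))| ≤ δ := by
  sorry

/-! ### Name-keyed aliases of the stub statements (verbatim) -/
namespace Registered

/-- Window-variance (Fejér) decay of the one-body field `A_f(χ)` at `(σ, θ, f, χ, Φ)` at ONE window — the
recurring clause of the stubs (an ABBREVIATION for this namespace only; the stubs above inline it). -/
abbrev FejerDecay (σ θ : ℝ) (f : V3 → ℝ) (χ : T3 → ℝ)
    (Φ : (N : ℕ) → HardSphereFlow (Torus.geometry (Fin 3)) (hsDiameter σ N) (N + 1)) : Prop :=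
  ∀ δ : ℝ, 0 < δ → ∃ T : ℝ, 0 < T ∧ ∃ N₀ : ℕ, ∀ N : ℕ, N₀ ≤ N →
    ∫⁻ z, ENNReal.ofReal ((T⁻¹ * ∫ s in (0 : ℝ)..T,
        ∫ y, χ y.1 * f y.2
          ∂(empiricalMeasure ((Φ N).flow (s * ((N : ℝ) + 1) ^ (-(1 / 3 : ℝ))) z))) ^ 2)
      ∂(localGibbsLaw σ (fun _ => 1) (fun _ => 0) (fun _ => θ) N (Φ N))
      ≤ ENNReal.ofReal (δ / ((N : ℝ) + 1))

/-- Window-variance decay at ALL large windows (`∀ δ ∃ T₀ ∀ T ≥ T₀ ∃ N₀ ∀ N ≥ N₀`). -/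
abbrev FejerDecayAll (σ θ : ℝ) (f : V3 → ℝ) (χ : T3 → ℝ)
    (Φ : (N : ℕ) → HardSphereFlow (Torus.geometry (Fin 3)) (hsDiameter σ N) (N + 1)) : Prop :=
  ∀ δ : ℝ, 0 < δ → ∃ T₀ : ℝ, 0 < T₀ ∧ ∀ T : ℝ, T₀ ≤ T → ∃ N₀ : ℕ, ∀ N : ℕ, N₀ ≤ N →
    ∫⁻ z, ENNReal.ofReal ((T⁻¹ * ∫ s in (0 : ℝ)..T,
        ∫ y, χ y.1 * f y.2
          ∂(empiricalMeasure ((Φ N).flow (s * ((N : ℝ) + 1) ^ (-(1 / 3 : ℝ))) z))) ^ 2)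
      ∂(localGibbsLaw σ (fun _ => 1) (fun _ => 0) (fun _ => θ) N (Φ N))
      ≤ ENNReal.ofReal (δ / ((N : ℝ) + 1))

/-- Verbatim statement of `stub_coreFejer`. -/
abbrev stub_coreFejer : Prop :=
    ∃ σ₀ : ℝ, 0 < σ₀ ∧ ∀ σ : ℝ, 0 < σ → σ < σ₀ → ∀ θ : ℝ, 0 < θ →
      ∀ g : V3 → ℝ, Continuous g → (∃ K : ℝ, ∀ v, |g v| ≤ K) →
        (∫ v, g v * localMaxwellian 1 θ (0 : V3) v = 0) →
        (∀ i : Fin 3, ∫ v, g v * v i * localMaxwellian 1 θ (0 : V3) v = 0) →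
        (∫ v, g v * ‖v‖ ^ 2 * localMaxwellian 1 θ (0 : V3) v = 0) →
        ∀ (Φ : (N : ℕ) → HardSphereFlow (Torus.geometry (Fin 3)) (hsDiameter σ N) (N + 1))
          (n : Fin 3 → ℤ),
          FejerDecay σ θ g (fun x => (mFourier n x).re) Φ ∧ FejerDecay σ θ g (fun x => (mFourier n x).im) Φ

/-- Verbatim statement of `stub_coreFejerOfFOME`. -/
abbrev stub_coreFejerOfFOME : Prop :=
    FastObservableMeanErgodic → stub_coreFejer

/-- Verbatim statement of `stub_fejerWindowMonotone`. -/
abbrev stub_fejerWindowMonotone : Prop :=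
    ∀ σ : ℝ, 0 < σ → σ < 1 / 2 → ∀ θ : ℝ, 0 < θ →
      ∀ g : V3 → ℝ, Continuous g → (∃ K : ℝ, ∀ v, |g v| ≤ K) →
        (∫ v, g v * localMaxwellian 1 θ (0 : V3) v = 0) →
        ∀ (Φ : (N : ℕ) → HardSphereFlow (Torus.geometry (Fin 3)) (hsDiameter σ N) (N + 1))
          (χ : T3 → ℝ), Continuous χ → FejerDecay σ θ g χ Φ → FejerDecayAll σ θ g χ Φ

/-- Verbatim statement of `stub_testFunctionDensityAll`. -/
abbrev stub_testFunctionDensityAll : Prop :=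
    ∀ σ : ℝ, 0 < σ → σ < 1 / 2 → ∀ θ : ℝ, 0 < θ →
      ∀ g : V3 → ℝ, Continuous g → (∃ K : ℝ, ∀ v, |g v| ≤ K) →
        (∫ v, g v * localMaxwellian 1 θ (0 : V3) v = 0) →
        ∀ Φ : (N : ℕ) → HardSphereFlow (Torus.geometry (Fin 3)) (hsDiameter σ N) (N + 1),
          (∀ n : Fin 3 → ℤ,
            FejerDecayAll σ θ g (fun x => (mFourier n x).re) Φ ∧
              FejerDecayAll σ θ g (fun x => (mFourier n x).im) Φ) →
          ∀ χ : T3 → ℝ, Continuous χ → FejerDecayAll σ θ g χ Φ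

/-- Verbatim statement of `stub_profileDensityAll`. -/
abbrev stub_profileDensityAll : Prop :=
    ∀ σ : ℝ, 0 < σ → σ < 1 / 2 → ∀ θ : ℝ, 0 < θ →
      ∀ (Φ : (N : ℕ) → HardSphereFlow (Torus.geometry (Fin 3)) (hsDiameter σ N) (N + 1))
        (χ : T3 → ℝ), Continuous χ →
        (∀ g : V3 → ℝ, Continuous g → (∃ K : ℝ, ∀ v, |g v| ≤ K) →
          (∫ v, g v * localMaxwellian 1 θ (0 : V3) v = 0) →
          (∀ i : Fin 3, ∫ v, g v * v i * localMaxwellian 1 θ (0 : V3) v = 0) →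
          (∫ v, g v * ‖v‖ ^ 2 * localMaxwellian 1 θ (0 : V3) v = 0) → FejerDecayAll σ θ g χ Φ) →
        ∀ h : V3 → ℝ, Continuous h → (∃ (C : ℝ) (k : ℕ), ∀ v, |h v| ≤ C * (1 + ‖v‖) ^ k) →
          (∫ v, h v * localMaxwellian 1 θ (0 : V3) v = 0) →
          (∀ i : Fin 3, ∫ v, h v * v i * localMaxwellian 1 θ (0 : V3) v = 0) →
          (∫ v, h v * ‖v‖ ^ 2 * localMaxwellian 1 θ (0 : V3) v = 0) → FejerDecayAll σ θ h χ Φ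

/-- Verbatim statement of `stub_windowToCesaroAll`. -/
abbrev stub_windowToCesaroAll : Prop :=
    ∀ σ : ℝ, 0 < σ → σ < 1 / 2 → ∀ θ : ℝ, 0 < θ →
      ∀ h : V3 → ℝ, Continuous h → (∃ (C : ℝ) (k : ℕ), ∀ v, |h v| ≤ C * (1 + ‖v‖) ^ k) →
        (∫ v, h v * localMaxwellian 1 θ (0 : V3) v = 0) →
        ∀ (Φ : (N : ℕ) → HardSphereFlow (Torus.geometry (Fin 3)) (hsDiameter σ N) (N + 1))
          (χ : T3 → ℝ), Continuous χ → FejerDecayAll σ θ h χ Φ →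
          ∀ δ : ℝ, 0 < δ → ∃ S₀ : ℝ, 0 < S₀ ∧ ∀ S : ℝ, S₀ ≤ S → ∃ N₀ : ℕ, ∀ N : ℕ, N₀ ≤ N →
            |S⁻¹ * ∫ s in (0 : ℝ)..S, ((N : ℝ) + 1) * ∫ z,
                (∫ y, χ y.1 * h y.2
                    ∂(empiricalMeasure ((Φ N).flow (s * ((N : ℝ) + 1) ^ (-(1 / 3 : ℝ))) z))) *
                  (∫ y, χ y.1 * h y.2 ∂(empiricalMeasure z))
                ∂(localGibbsLaw σ (fun _ => 1) (fun _ => 0) (fun _ => θ) N (Φ N))| ≤ δ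

end Registered

/-! ### Wiring: the aliases ARE the stub statements (definitional) -/

example : Registered.stub_coreFejer := stub_coreFejer
example : Registered.stub_coreFejerOfFOME := stub_coreFejerOfFOME
example : Registered.stub_fejerWindowMonotone := stub_fejerWindowMonotone
example : Registered.stub_testFunctionDensityAll := stub_testFunctionDensityAll
example : Registered.stub_profileDensityAll := stub_profileDensityAll
example : Registered.stub_windowToCesaroAll := stub_windowToCesaroAll

/-! ### The compositions (sorry-free): the stubs prove the crux BY NAME -/

/-- `torus-fejer` v2 COMPOSITION: core (S4) → window monotonicity (S0) → test-function density (S2) →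
profile density (S3) → window-to-Cesàro (S1) → `OneBodyCompleteness` (the route decl, by name).
Pure logic: `σ₀ := min σ₀(core) (1/2)`. -/
theorem OneBodyCompleteness_of (hcore : Registered.stub_coreFejer)
    (hmono : Registered.stub_fejerWindowMonotone) (htest : Registered.stub_testFunctionDensityAll)
    (hprof : Registered.stub_profileDensityAll) (hwin : Registered.stub_windowToCesaroAll) :
    OneBodyCompleteness := by
  obtain ⟨σ₀, hσ₀, hc⟩ := hcore
  refine ⟨min σ₀ (1 / 2), lt_min hσ₀ one_half_pos, ?_⟩
  intro σ hσ hσlt θ hθ h hh hpoly h1 hv hE Φ χ hχ δ hδ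
  have hσ₀' : σ < σ₀ := lt_of_lt_of_le hσlt (min_le_left _ _)
  have hσ2 : σ < 1 / 2 := lt_of_lt_of_le hσlt (min_le_right _ _)
  have hre : ∀ n : Fin 3 → ℤ, Continuous fun x : T3 => (mFourier n x).re := fun n =>
    Complex.continuous_re.comp (mFourier n).continuous
  have him : ∀ n : Fin 3 → ℤ, Continuous fun x : T3 => (mFourier n x).im := fun n =>
    Complex.continuous_im.comp (mFourier n).continuous
  -- all-window decay for every bounded continuous `g ⊥ {1, v, |v|²}` and the given `χ`
  have hG : ∀ g : V3 → ℝ, Continuous g → (∃ K : ℝ, ∀ v, |g v| ≤ K) →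
      (∫ v, g v * localMaxwellian 1 θ (0 : V3) v = 0) →
      (∀ i : Fin 3, ∫ v, g v * v i * localMaxwellian 1 θ (0 : V3) v = 0) →
      (∫ v, g v * ‖v‖ ^ 2 * localMaxwellian 1 θ (0 : V3) v = 0) →
      Registered.FejerDecayAll σ θ g χ Φ := by
    intro g hg hK g1 gv gE
    refine htest σ hσ hσ2 θ hθ g hg hK g1 Φ (fun n => ⟨?_, ?_⟩) χ hχ
    · exact hmono σ hσ hσ2 θ hθ g hg hK g1 Φ _ (hre n) (hc σ hσ hσ₀' θ hθ g hg hK g1 gv gE Φ n).1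
    · exact hmono σ hσ hσ2 θ hθ g hg hK g1 Φ _ (him n) (hc σ hσ hσ₀' θ hθ g hg hK g1 gv gE Φ n).2
  have hF : Registered.FejerDecayAll σ θ h χ Φ := hprof σ hσ hσ2 θ hθ Φ χ hχ hG h hh hpoly h1 hv hE
  exact hwin σ hσ hσ2 θ hθ h hh hpoly h1 Φ χ hχ hF δ hδ

/-- The same composition entered through the TRANSFER STUB: the crux from the existing typed item
`FastObservableMeanErgodic` (stmt-AtomisticToContinuum-10952) and the five provable stubs. -/
theorem OneBodyCompleteness_of_fastObservableMeanErgodic (hbridge : Registered.stub_coreFejerOfFOME)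
    (hmono : Registered.stub_fejerWindowMonotone) (htest : Registered.stub_testFunctionDensityAll)
    (hprof : Registered.stub_profileDensityAll) (hwin : Registered.stub_windowToCesaroAll)
    (hFOME : FastObservableMeanErgodic) : OneBodyCompleteness :=
  OneBodyCompleteness_of (hbridge hFOME) hmono htest hprof hwin

/-- The composition with the stubs plugged in: the line closes the crux modulo exactly the registered
`stub_*` (sorries live only there). -/
theorem OneBodyCompleteness_of_stubs : OneBodyCompleteness :=
  OneBodyCompleteness_of stub_coreFejer stub_fejerWindowMonotone stub_testFunctionDensityAll
    stub_profileDensityAll stub_windowToCesaroAll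

/-- … and entered through FOME (sorries only in the five PROVABLE stubs + the named item as hypothesis). -/
theorem OneBodyCompleteness_of_stubs_fome (hFOME : FastObservableMeanErgodic) : OneBodyCompleteness :=
  OneBodyCompleteness_of_fastObservableMeanErgodic stub_coreFejerOfFOME stub_fejerWindowMonotone
    stub_testFunctionDensityAll stub_profileDensityAll stub_windowToCesaroAll hFOME

end Summit.AtomisticToContinuum.HydrodynamicLimit.Cruxes.OneBodyCompleteness.TorusFejer

end
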